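import Mathlib
import Literature.MathematicalPhysics.QuantumFieldTheory.Balaban1983to89.B16Sect1SmallFactors
import Literature.MathematicalPhysics.QuantumFieldTheory.Balaban1983to89.B12CauchyRemainder354

/-!
# `Balaban1983to89.B16Ineq128FirstOrder` — [Balaban1989LargeFieldII] p. 363, the first-order clause after (1.28):
«hence the first order term in this expansion can be bounded by this number multiplied by the right-hand side of
the inequality (1.23), and by some absolute constant» — r13's typed leaf `B16Sect1Statements.Ineq128first` DERIVED
from its printed inputs by the Cauchy estimate

T. Bałaban, *Large field renormalization. II. Localization, exponentiation, and bounds for the 𝐑 operation*, Commun.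
Math. Phys. **122** (1989) 355–392 [Balaban1989LargeFieldII] (cell paper B16; PDF held
`paper:balaban1989-cmp122-large-field-ii`, journal page = PDF page + 354; p. 363 = PDF 9, p. 362 = PDF 8 — both RE-READ
AS IMAGES by this seat on the x2 renders `run/shared/lean/pub/pub-balaban/b2b-balaban-ref1/pages/1989-cmp122-large-field-II/
…-p008-x2.png`, `…-p009-x2.png`; the text layer garbles the displays).

statement-level skeleton of published theorems with citation tags; proofs where landed; nothing here is a claim about
the Yang–Mills mass gap

CITATION HEADER / WHAT IS REPRODUCED.  Mega-formalization `lit-balaban`, HOME `run/shared/lean/pub/lit-balaban/`;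
reader/typer **r13 gen 13** (B16 display-level owner; rows `lit-balaban-r13/ROWS-B16.md` v2.46).  SKELETON row
**B16.Eq1.28** (owner r13): the display (1.28) `g_k⟨DH″_{1,k,X₀}B, ζη⁻² Im ∂U⁰_{k,Z}⟩` and the two in-text bounds that
follow it were typed by r13 gen 2 (`B16Sect1Statements.Ineq128simple` — the «simple estimate» — and
`B16Sect1Statements.Ineq128first` — the first-order bound, p240851); the closing clause «Thus the first order term of this
expansion is small» was PROVED by r13 gen 8 from `Ineq128first` as a hypothesis (`B16Sect1SmallFactors.ineq128first_small`,
`ineq128first_div_small`, p254349).  What was NOT in the tree is the printed STEP «simple estimate ⟹ first-order bound»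
— the word «hence».  This file proves it.

THE PRINT (p. 363 [PDF 9], verbatim): *«The first term is equal to g_k⟨DH″_{1,k,X₀}B, ζη⁻² Im ∂U⁰_{k,Z}⟩. (1.28)  This
expression depends on the background field U⁰_{k,Z} restricted to the domain Z ∩ Ω″~_{h+1} (or rather to the
neighborhood of this domain obtained by adding the boundary layer of the width 5M₁L^{−N+1} at the boundary ∂Ω″~_{h+1}),
and the dependence is analytic.  We apply the representation (1.22), and we expand (1.28) up to the first order in
𝐇_{𝐁₁}.  A simple estimate of the expression (1.28) gives the bound g_k²O(1)A₀²B₃²B₅M^{d+5}R_k^dp₀²(g_k), hence the first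
order term in this expansion can be bounded by this number multiplied by the right-hand side of the inequality (1.23),
and by some absolute constant.  Thus the first order term of this expansion is small, and we have to consider the
expression (1.28) with U⁰_{k,Z} replaced by U⁰_{𝐁₁}.»*  The representation (1.22) (p. 361) is
`U⁰_{k,Z} = (exp(iη𝐇_{𝐁₁}) U⁰_{𝐁₁})^{gauge}`, and (1.23) (p. 362) reads `L^jη|𝐇_{𝐁₁}|, (L^jη)²|∇^η_{U⁰(𝐁₁)}𝐇_{𝐁₁}| <
B₃exp(−δMR_{h+1})11d²(1+β₀)²R_k^{β₀}ε_k =: rhs123` on `Ω″_j ∩ Ω^c_k`.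

THE MECHANISM («hence» = Cauchy's estimate).  Write `𝔉(𝐇) := g_k⟨DH″_{1,k,X₀}B, ζη⁻² Im ∂[exp(iη𝐇)U⁰_{𝐁₁}]⟩`, the
expression (1.28) as a function of the representation field of (1.22) (the pairing is gauge invariant, so the gauge
transformation of (1.22) drops out exactly as in (1.17)/(1.24)), extended analytically to complex `𝐇` as print says; and
let `ψ(z) := 𝔉(z·𝐇_{𝐁₁})` be its restriction to the complexified ray through the actual field `𝐇_{𝐁₁}`.  Measuring `𝐇`
in the (1.23)-size `‖𝐇‖ := sup_x max(L^jη|𝐇(x)|, (L^jη)²|∇𝐇(x)|)`, analyticity on the ball `‖𝐇‖ < r₀` (an absolute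
radius: the configurations `exp(iη𝐇)U⁰_{𝐁₁}` stay in the regular class) makes `ψ` holomorphic on the disc
`|z| < r₀/ρ`, `ρ := ‖𝐇_{𝐁₁}‖`, and the «simple estimate» — which uses nothing but the regular-class bounds of the
configuration — bounds `|ψ| ≤ S := g_k²O(1)A₀²B₃²B₅M^{d+5}R_k^dp₀²(g_k)` on that disc.  The first-order term of the
expansion in `𝐇_{𝐁₁}` is `T₁ = D𝔉(0)[𝐇_{𝐁₁}] = ψ′(0)`, and Cauchy's estimate on the disc gives
`|T₁| ≤ S/(r₀/ρ) = S·ρ·r₀⁻¹ ≤ S · rhs123 · r₀⁻¹` by (1.23) — the printed sentence with the absolute constant `C′ = r₀⁻¹`.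
(Under the other possible reading of «expand up to the first order» — the whole first-order difference
`𝔉(𝐇_{𝐁₁}) − 𝔉(0) = ψ(1) − ψ(0)` — the same estimate along the segment gives `≤ S·ρ/(r₀ − ρ) ≤ 2S·rhs123·r₀⁻¹` once
`rhs123 ≤ r₀/2`; both readings are proved, §1–§2.)

WHAT THIS FILE PROVES (kernel-checked, zero `sorry`, THEOREMS ONLY — no definition, no named fact; axioms standard;
BY NAME: `B16Sect1Statements.Ineq128simple` / `Ineq128first` / `Ineq123` / `rhs123` (r13 gen 2),
`B16Sect1SmallFactors.ineq128first_div_small` (r13 gen 8), `B12CauchyRemainder354.norm_iteratedDeriv_le_of_ball` (r09's sharp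
open-disc Cauchy estimate, p. 280 [I] (3.54) API) — nothing re-proved).
§1 `norm_deriv_le_of_ball` (‖ψ′(0)‖ ≤ S/R from a sup bound on the OPEN disc of radius R — `n = 1` of r09's lemma),
   **`firstOrder_norm_le`** (‖ψ′(0)‖ ≤ S·ρ/r₀ on the disc of radius r₀/ρ), `remainder_norm_le` (‖ψ(1) − ψ(0)‖ ≤ S·ρ/(r₀ − ρ)
   for ρ < r₀: Cauchy at every point of the unit segment + the mean-value inequality).
§2 **`ineq128first_of_simple`** — `Ineq128first T₁ gk C A₀ B₃ B₅ M Rk p₀g d δ Rh1 β₀ εk r₀⁻¹` AS TYPED from: analyticity of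
   ψ on the disc `|z| < r₀/ρ`, the simple estimate `Ineq128simple ‖ψ z‖ …` BY NAME at every point of that disc, the
   (1.23)-size letter `ρ ≤ rhs123 …`, and the dictionary letter `|T₁| ≤ ‖ψ′(0)‖` (e.g. `T₁ = Re ψ′(0)`,
   `ineq128first_of_simple_re`); `ineq128first_of_simple'` — the same with the disc radius `r₀/rhs123` and no `ρ`
   (since `ρ ≤ rhs123`, analyticity on `|z| < r₀/ρ` contains that disc: `differentiableOn_disc_of_size_le`);
   `ineq128first_remainder_of_simple` — the remainder reading, constant `2r₀⁻¹`, under `rhs123 ≤ r₀/2`.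
§3 `size123_lt_rhs123` — the (1.23)-size of `𝐇_{𝐁₁}` over a finite set of points is `< rhs123` from (1.23) `Ineq123` BY
   NAME at every point (discharges the size letter with `ρ :=` that size, or with `ρ := rhs123`); `rhs123_pos`.
§4 **`ineq128first_small_of_simple`** — END TO END with r13 gen 8: p. 363 «Thus the first order term of this expansion is
   small» — for every `τ > 0` there is `g₀ > 0` (depending on the constants only) such that the inputs of §2 (radius
   `r₀/rhs123`) give `|T₁|/g_k² ≤ τ` whenever `0 < g_k ≤ g₀` along the [III] (2.4)–(2.5) dictionary
   (`B16Sect1SmallFactors.ineq128first_div_small` ∘ `ineq128first_of_simple'`).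
HONEST SCOPE.  Located hypotheses, NOT discharged here: (a) the analyticity of (1.28) in the representation field on a
ball of ABSOLUTE radius `r₀` in the (1.23)-size (print: «the dependence is analytic»; Sect. G [15] machinery, rows of
block B11) — entering only through `DifferentiableOn ℂ ψ (ball 0 (r₀/ρ))`; (b) the «simple estimate» `Ineq128simple`
(row B16.Eq1.28's first Prop, an analytic leaf resting on the regularity of the backgrounds) UNIFORMLY on that disc —
print states it for «the expression (1.28)»; its validity for every configuration `exp(iη𝐇)U⁰_{𝐁₁}`, `‖𝐇‖ < r₀`, is
the standard content of the word «hence» (READING, recorded; the same «uniform on the parameter polydiscs» reading as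
r10's B13.Eq2.26, G.5-45); (c) the identification of print's «first order term» with `ψ′(0)` (or with `ψ(1) − ψ(0)`,
both served).  Nothing about `H″_{1,k,X₀}`, `U⁰_{𝐁₁}`, `ζ` is constructed; (1.23) is used, not re-proved (row
B16.Eq1.23, proved p304610 from [15] (190)).  NOT summit progress.
-/

namespace Literature.MathematicalPhysics.QuantumFieldTheory.Balaban1983to89.B16Ineq128FirstOrder

open Set Metric Filter
open scoped Topology
open Literature.MathematicalPhysics.QuantumFieldTheory.Balaban1983to89
open B16Sect1Statements B12CauchyRemainder354

noncomputable section

variable {F : Type*} [NormedAddCommGroup F] [NormedSpace ℂ F] [CompleteSpace F]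

/-! ## §1. Cauchy's estimate for the first-order term along a ray -/

/-- Cauchy's estimate for the first derivative from a sup bound on the OPEN disc: `ψ` holomorphic on `|z| < R` with
`‖ψ‖ ≤ S` there gives `‖ψ′(0)‖ ≤ S/R` (the case `n = 1` of r09's `B12CauchyRemainder354.norm_iteratedDeriv_le_of_ball`,
sharp radius by `ρ ↑ R`). [cite: Balaban1989LargeFieldII, (1.28) p.363] (elementary API for the «hence» of p. 363:
Cauchy's inequality) -/
theorem norm_deriv_le_of_ball {ψ : ℂ → F} {R S : ℝ} (hR : 0 < R) (hψ : DifferentiableOn ℂ ψ (ball 0 R))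
    (hS : ∀ z ∈ ball (0 : ℂ) R, ‖ψ z‖ ≤ S) : ‖deriv ψ 0‖ ≤ S / R := by
  have h := norm_iteratedDeriv_le_of_ball hR hψ hS 1
  simpa [iteratedDeriv_one] using h

/-- **The first-order term along a ray.**  If `ψ(z) = 𝔉(z·𝐇)` is holomorphic on the disc `|z| < r₀/ρ` (`𝔉` analytic on
the ball of size-radius `r₀`, `ρ ≥` the size of `𝐇`, `ρ > 0`) and `‖ψ‖ ≤ S` there, then the first-order term
`T₁ = ψ′(0) = D𝔉(0)[𝐇]` satisfies `‖ψ′(0)‖ ≤ S·ρ/r₀`. [cite: Balaban1989LargeFieldII, (1.28) p.363] -/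
theorem firstOrder_norm_le {ψ : ℂ → F} {r₀ ρ S : ℝ} (hr₀ : 0 < r₀) (hρ : 0 < ρ)
    (hψ : DifferentiableOn ℂ ψ (ball 0 (r₀ / ρ))) (hS : ∀ z ∈ ball (0 : ℂ) (r₀ / ρ), ‖ψ z‖ ≤ S) :
    ‖deriv ψ 0‖ ≤ S * ρ / r₀ := by
  have h := norm_deriv_le_of_ball (div_pos hr₀ hρ) hψ hS
  rwa [div_div_eq_mul_div] at h

/-- **The whole first-order difference along a ray** (the other reading of «expand up to the first order»): if
`ψ` is holomorphic on `|z| < r₀/ρ` with `‖ψ‖ ≤ S` there and `ρ < r₀` (so that `z = 1` lies in the disc), then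
`‖ψ(1) − ψ(0)‖ ≤ S·ρ/(r₀ − ρ)` — Cauchy's estimate at every point of the unit segment (disc of radius `r₀/ρ − 1`
around it) and the mean-value inequality on the segment. [cite: Balaban1989LargeFieldII, (1.28) p.363] -/
theorem remainder_norm_le {ψ : ℂ → F} {r₀ ρ S : ℝ} (hρ : 0 < ρ) (hρr : ρ < r₀)
    (hψ : DifferentiableOn ℂ ψ (ball 0 (r₀ / ρ))) (hS : ∀ z ∈ ball (0 : ℂ) (r₀ / ρ), ‖ψ z‖ ≤ S) :
    ‖ψ 1 - ψ 0‖ ≤ S * ρ / (r₀ - ρ) := by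
  set R : ℝ := r₀ / ρ with hR_def
  have hR1 : 1 < R := by rw [hR_def, lt_div_iff₀ hρ]; linarith
  -- Cauchy at every point of the closed unit disc, with the disc of radius R − 1 around it
  have hder : ∀ w ∈ closedBall (0 : ℂ) 1, ‖deriv ψ w‖ ≤ S / (R - 1) := by
    intro w hw
    have hw1 : ‖w‖ ≤ 1 := mem_closedBall_zero_iff.mp hw
    have hsub : ball w (R - 1) ⊆ ball 0 R := by
      intro z hz
      rw [mem_ball_zero_iff]
      have hz' : ‖z - w‖ < R - 1 := mem_ball_iff_norm.mp hz
      calc ‖z‖ = ‖(z - w) + w‖ := by ring_nf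
        _ ≤ ‖z - w‖ + ‖w‖ := norm_add_le _ _
        _ < (R - 1) + 1 := add_lt_add_of_lt_of_le hz' hw1
        _ = R := by ring
    have hψw : DifferentiableOn ℂ (fun z => ψ (z + w)) (ball 0 (R - 1)) := by
      intro z hz
      have hzw : z + w ∈ ball w (R - 1) := by
        rw [mem_ball_iff_norm]; simpa using mem_ball_zero_iff.mp hz
      have h1 : DifferentiableAt ℂ ψ (z + w) :=
        (hψ (z + w) (hsub hzw)).differentiableAt (isOpen_ball.mem_nhds (hsub hzw))
      exact (h1.comp z ((differentiableAt_id).add (differentiableAt_const w))).differentiableWithinAt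
    have hSw : ∀ z ∈ ball (0 : ℂ) (R - 1), ‖ψ (z + w)‖ ≤ S := fun z hz => by
      have hzw : z + w ∈ ball w (R - 1) := by
        rw [mem_ball_iff_norm]; simpa using mem_ball_zero_iff.mp hz
      exact hS (z + w) (hsub hzw)
    have h := norm_deriv_le_of_ball (by linarith) hψw hSw
    have hshift : deriv (fun z => ψ (z + w)) 0 = deriv ψ w := by
      rw [deriv_comp_add_const]; simp
    rwa [hshift] at h
  -- mean-value inequality on the segment [0, 1] ⊆ closedBall 0 1
  have hdiff : ∀ w ∈ closedBall (0 : ℂ) 1, DifferentiableAt ℂ ψ w := by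
    intro w hw
    have hwR : w ∈ ball (0 : ℂ) R := by
      rw [mem_ball_zero_iff]; exact (mem_closedBall_zero_iff.mp hw).trans_lt hR1
    exact (hψ w hwR).differentiableAt (isOpen_ball.mem_nhds hwR)
  have hmv := (convex_closedBall (0 : ℂ) 1).norm_image_sub_le_of_norm_deriv_le hdiff hder
    (mem_closedBall_self zero_le_one) (by simp : (1 : ℂ) ∈ closedBall (0 : ℂ) 1)
  have hS0 : 0 ≤ S := (norm_nonneg _).trans (hS 0 (mem_ball_self (by linarith)))
  calc ‖ψ 1 - ψ 0‖ ≤ S / (R - 1) * ‖(1 : ℂ) - 0‖ := hmv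
    _ = S / (R - 1) := by simp
    _ = S * ρ / (r₀ - ρ) := by
        rw [hR_def]
        have hρ0 : ρ ≠ 0 := hρ.ne'
        have h1 : r₀ / ρ - 1 = (r₀ - ρ) / ρ := by field_simp
        rw [h1, div_div_eq_mul_div]

/-! ## §2. The first-order clause of p. 363 AS TYPED (row B16.Eq1.28) -/

/-- **p. 363, «hence the first order term in this expansion can be bounded by this number multiplied by the right-hand
side of the inequality (1.23), and by some absolute constant»** — r13's leaf `B16Sect1Statements.Ineq128first T₁ gk C A₀
B₃ B₅ M Rk p₀g d δ Rh1 β₀ εk C′` AS TYPED with the absolute constant `C′ = r₀⁻¹`, from its printed inputs: the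
restriction `ψ(z) = 𝔉(z·𝐇_{𝐁₁})` of (1.28) (as a function of the representation field of (1.22)) to the complexified
ray is holomorphic on the disc `|z| < r₀/ρ` («the dependence is analytic»; `r₀` = the absolute size-radius of
analyticity, `ρ` = the (1.23)-size of `𝐇_{𝐁₁}`), the «simple estimate» `Ineq128simple ‖ψ z‖ gk C A₀ B₃ B₅ M Rk p₀g d`
holds at every point of that disc, `ρ ≤ rhs123` (the inequality (1.23), row B16.Eq1.23; §3 discharges this letter
from `Ineq123` pointwise), and `T₁` is the first-order term: `|T₁| ≤ ‖ψ′(0)‖`.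
[cite: Balaban1989LargeFieldII, (1.28) p.363, (1.23) p.362] -/
theorem ineq128first_of_simple {ψ : ℂ → F} {r₀ ρ gk C A₀ B₃ B₅ M Rk p₀g δ Rh1 β₀ εk T₁ : ℝ} {d : ℕ}
    (hr₀ : 0 < r₀) (hρ : 0 < ρ) (hψ : DifferentiableOn ℂ ψ (ball 0 (r₀ / ρ)))
    (hS : ∀ z ∈ ball (0 : ℂ) (r₀ / ρ), Ineq128simple ‖ψ z‖ gk C A₀ B₃ B₅ M Rk p₀g d)
    (hρ123 : ρ ≤ rhs123 B₃ δ M Rh1 d β₀ Rk εk) (hT : |T₁| ≤ ‖deriv ψ 0‖) :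
    Ineq128first T₁ gk C A₀ B₃ B₅ M Rk p₀g d δ Rh1 β₀ εk r₀⁻¹ := by
  set S : ℝ := gk ^ 2 * C * A₀ ^ 2 * B₃ ^ 2 * B₅ * M ^ (d + 5) * Rk ^ d * p₀g ^ 2 with hS_def
  have hS' : ∀ z ∈ ball (0 : ℂ) (r₀ / ρ), ‖ψ z‖ ≤ S := fun z hz => by
    have h := hS z hz
    unfold Ineq128simple at h
    rwa [abs_norm] at h
  have hS0 : 0 ≤ S := (norm_nonneg _).trans (hS' 0 (mem_ball_self (div_pos hr₀ hρ)))
  have h1 := firstOrder_norm_le hr₀ hρ hψ hS'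
  unfold Ineq128first
  calc |T₁| ≤ ‖deriv ψ 0‖ := hT
    _ ≤ S * ρ / r₀ := h1
    _ ≤ S * rhs123 B₃ δ M Rh1 d β₀ Rk εk / r₀ := by gcongr
    _ = S * rhs123 B₃ δ M Rh1 d β₀ Rk εk * r₀⁻¹ := by rw [div_eq_mul_inv]

/-- The same with the printed real first-order term read as `T₁ = Re ψ′(0)` (for the (1.28) expression `F = ℂ`; on the
real ray `ψ` is real, so this IS `ψ′(0)`): `|Re ψ′(0)| ≤ ‖ψ′(0)‖`. [cite: Balaban1989LargeFieldII, (1.28) p.363] -/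
theorem ineq128first_of_simple_re {ψ : ℂ → ℂ} {r₀ ρ gk C A₀ B₃ B₅ M Rk p₀g δ Rh1 β₀ εk : ℝ} {d : ℕ}
    (hr₀ : 0 < r₀) (hρ : 0 < ρ) (hψ : DifferentiableOn ℂ ψ (ball 0 (r₀ / ρ)))
    (hS : ∀ z ∈ ball (0 : ℂ) (r₀ / ρ), Ineq128simple ‖ψ z‖ gk C A₀ B₃ B₅ M Rk p₀g d)
    (hρ123 : ρ ≤ rhs123 B₃ δ M Rh1 d β₀ Rk εk) :
    Ineq128first (deriv ψ 0).re gk C A₀ B₃ B₅ M Rk p₀g d δ Rh1 β₀ εk r₀⁻¹ :=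
  ineq128first_of_simple hr₀ hρ hψ hS hρ123 (Complex.abs_re_le_norm _)

omit [CompleteSpace F] in
/-- Monotonicity of the disc in the size letter: analyticity on `|z| < r₀/ρ` for the TRUE size `ρ` of `𝐇_{𝐁₁}` contains
the disc `|z| < r₀/ρ′` for any `ρ′ ≥ ρ` — in particular for `ρ′ = rhs123` by (1.23). Bookkeeping.
[cite: Balaban1989LargeFieldII, (1.28) p.363, (1.23) p.362] -/
theorem differentiableOn_disc_of_size_le {ψ : ℂ → F} {r₀ ρ ρ' : ℝ} (hr₀ : 0 ≤ r₀) (hρ : 0 < ρ) (hρρ' : ρ ≤ ρ')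
    (hψ : DifferentiableOn ℂ ψ (ball 0 (r₀ / ρ))) : DifferentiableOn ℂ ψ (ball 0 (r₀ / ρ')) :=
  hψ.mono (ball_subset_ball (div_le_div_of_nonneg_left hr₀ hρ hρρ'))

/-- **The first-order clause with the disc radius `r₀/rhs123` and no size letter**: since the (1.23)-size of `𝐇_{𝐁₁}`
is `< rhs123` (row B16.Eq1.23), it suffices that `ψ` be holomorphic with the simple estimate on the disc
`|z| < r₀/rhs123`; then `Ineq128first T₁ … r₀⁻¹`. [cite: Balaban1989LargeFieldII, (1.28) p.363, (1.23) p.362] -/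
theorem ineq128first_of_simple' {ψ : ℂ → F} {r₀ gk C A₀ B₃ B₅ M Rk p₀g δ Rh1 β₀ εk T₁ : ℝ} {d : ℕ}
    (hr₀ : 0 < r₀) (h123pos : 0 < rhs123 B₃ δ M Rh1 d β₀ Rk εk)
    (hψ : DifferentiableOn ℂ ψ (ball 0 (r₀ / rhs123 B₃ δ M Rh1 d β₀ Rk εk)))
    (hS : ∀ z ∈ ball (0 : ℂ) (r₀ / rhs123 B₃ δ M Rh1 d β₀ Rk εk), Ineq128simple ‖ψ z‖ gk C A₀ B₃ B₅ M Rk p₀g d)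
    (hT : |T₁| ≤ ‖deriv ψ 0‖) :
    Ineq128first T₁ gk C A₀ B₃ B₅ M Rk p₀g d δ Rh1 β₀ εk r₀⁻¹ :=
  ineq128first_of_simple hr₀ h123pos hψ hS le_rfl hT

/-- **The remainder reading.**  If «the first order term in this expansion» is read as the whole first-order difference
`T₁ = 𝔉(𝐇_{𝐁₁}) − 𝔉(0) = ψ(1) − ψ(0)` (the expression (1.28) minus «the expression (1.28) with U⁰_{k,Z} replaced by
U⁰_{𝐁₁}»), the same inputs give `Ineq128first T₁ … (2r₀⁻¹)` once `rhs123 ≤ r₀/2` (true for `g_k` small: `rhs123` carries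
`exp(−δMR_{h+1})ε_k`). [cite: Balaban1989LargeFieldII, (1.28) p.363, (1.23) p.362] -/
theorem ineq128first_remainder_of_simple {ψ : ℂ → F} {r₀ ρ gk C A₀ B₃ B₅ M Rk p₀g δ Rh1 β₀ εk T₁ : ℝ} {d : ℕ}
    (hr₀ : 0 < r₀) (hρ : 0 < ρ) (hψ : DifferentiableOn ℂ ψ (ball 0 (r₀ / ρ)))
    (hS : ∀ z ∈ ball (0 : ℂ) (r₀ / ρ), Ineq128simple ‖ψ z‖ gk C A₀ B₃ B₅ M Rk p₀g d)
    (hρ123 : ρ ≤ rhs123 B₃ δ M Rh1 d β₀ Rk εk) (h123 : rhs123 B₃ δ M Rh1 d β₀ Rk εk ≤ r₀ / 2)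
    (hT : |T₁| ≤ ‖ψ 1 - ψ 0‖) :
    Ineq128first T₁ gk C A₀ B₃ B₅ M Rk p₀g d δ Rh1 β₀ εk (2 * r₀⁻¹) := by
  set S : ℝ := gk ^ 2 * C * A₀ ^ 2 * B₃ ^ 2 * B₅ * M ^ (d + 5) * Rk ^ d * p₀g ^ 2 with hS_def
  have hS' : ∀ z ∈ ball (0 : ℂ) (r₀ / ρ), ‖ψ z‖ ≤ S := fun z hz => by
    have h := hS z hz
    unfold Ineq128simple at h
    rwa [abs_norm] at h
  have hS0 : 0 ≤ S := (norm_nonneg _).trans (hS' 0 (mem_ball_self (div_pos hr₀ hρ)))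
  have hρr : ρ < r₀ := by linarith
  have h1 := remainder_norm_le hρ hρr hψ hS'
  -- ρ/(r₀ − ρ) ≤ 2ρ/r₀ ≤ 2·rhs123/r₀ for ρ ≤ rhs123 ≤ r₀/2
  have h2 : S * ρ / (r₀ - ρ) ≤ S * rhs123 B₃ δ M Rh1 d β₀ Rk εk * (2 * r₀⁻¹) := by
    have hden : r₀ / 2 ≤ r₀ - ρ := by linarith
    have hnum : 0 ≤ S * ρ := mul_nonneg hS0 hρ.le
    calc S * ρ / (r₀ - ρ) ≤ S * ρ / (r₀ / 2) := div_le_div_of_nonneg_left hnum (by positivity) hden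
      _ ≤ S * rhs123 B₃ δ M Rh1 d β₀ Rk εk / (r₀ / 2) :=
          div_le_div_of_nonneg_right (mul_le_mul_of_nonneg_left hρ123 hS0) (by positivity)
      _ = S * rhs123 B₃ δ M Rh1 d β₀ Rk εk * (2 * r₀⁻¹) := by
          rw [div_div_eq_mul_div, div_eq_mul_inv]; ring
  unfold Ineq128first
  exact hT.trans (h1.trans h2)

/-! ## §3. The (1.23)-size of `𝐇_{𝐁₁}` from (1.23) pointwise -/

/-- The right-hand side of (1.23) is positive for positive `B₃`, `R_k`, `ε_k` and `d ≥ 1`. Bookkeeping.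
[cite: Balaban1989LargeFieldII, (1.23) p.362] -/
theorem rhs123_pos {B₃ δ M Rh1 β₀ Rk εk : ℝ} {d : ℕ} (hB₃ : 0 < B₃) (hd : 1 ≤ d) (hβ₀ : 0 ≤ β₀) (hRk : 0 < Rk)
    (hεk : 0 < εk) : 0 < rhs123 B₃ δ M Rh1 d β₀ Rk εk := by
  unfold rhs123
  have hd' : (0 : ℝ) < d := by exact_mod_cast hd
  have hRβ : 0 < Rk ^ β₀ := Real.rpow_pos_of_pos hRk β₀
  have _ := hβ₀
  positivity

/-- **The (1.23)-size from (1.23) pointwise.**  Over a finite non-empty set of points `pts` (the points of the layers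
`Ω″_j ∩ Ω^c_k`, `j = h+1, …, k`, each with its scale factor `L^jη`), (1.23) `Ineq123 (Ljη x) (nH x) (nGradH x) …` BY
NAME at every point gives: the size `ρ = max_x max(L^jη|𝐇_{𝐁₁}(x)|, (L^jη)²|∇𝐇_{𝐁₁}(x)|)` is `< rhs123` — the letter
`hρ123` of §2. [cite: Balaban1989LargeFieldII, (1.23) p.362, (1.28) p.363] -/
theorem size123_lt_rhs123 {X : Type*} {pts : Finset X} (hne : pts.Nonempty) {Ljη nH nGradH : X → ℝ}
    {B₃ δ M Rh1 β₀ Rk εk : ℝ} {d : ℕ}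
    (h123 : ∀ x ∈ pts, Ineq123 (Ljη x) (nH x) (nGradH x) B₃ δ M Rh1 d β₀ Rk εk) :
    pts.sup' hne (fun x => max (Ljη x * nH x) (Ljη x ^ 2 * nGradH x)) < rhs123 B₃ δ M Rh1 d β₀ Rk εk := by
  rw [Finset.sup'_lt_iff]
  intro x hx
  exact max_lt (h123 x hx).1 (h123 x hx).2

/-- Every pointwise size is dominated by the (1.23)-size `ρ` (so `ρ` is an admissible size letter for §2: analyticity
on the size-`r₀` ball yields holomorphy of the ray function on `|z| < r₀/ρ`). Bookkeeping.
[cite: Balaban1989LargeFieldII, (1.23) p.362] -/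
theorem le_size123 {X : Type*} {pts : Finset X} (hne : pts.Nonempty) {Ljη nH nGradH : X → ℝ} {x : X}
    (hx : x ∈ pts) :
    Ljη x * nH x ≤ pts.sup' hne (fun x => max (Ljη x * nH x) (Ljη x ^ 2 * nGradH x)) ∧
      Ljη x ^ 2 * nGradH x ≤ pts.sup' hne (fun x => max (Ljη x * nH x) (Ljη x ^ 2 * nGradH x)) := by
  have h := Finset.le_sup' (fun x => max (Ljη x * nH x) (Ljη x ^ 2 * nGradH x)) hx
  exact ⟨(le_max_left _ _).trans h, (le_max_right _ _).trans h⟩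

/-! ## §4. END TO END with r13 gen 8: «Thus the first order term of this expansion is small» -/

/-- **p. 363, «Thus the first order term of this expansion is small»**, end to end: for every `τ > 0` there is `g₀ > 0`,
depending only on the constants `C, r₀, A₀, B₃, B₅, M, δ, β₀, L, p₀, r_exp, d`, such that along the [III] (2.4)–(2.5)
dictionary (`ℓ = log g_k⁻²`, `ℓ^{r} ≤ R_k ≤ Lℓ^{r}`, `R_k ≤ R_{h+1}`, `p₀(g_k) = ℓ^{p₀}`, `ε_k = g_kA₀p₀(g_k)`) the inputs of
§2 — holomorphy of the ray function of (1.28) on `|z| < r₀/rhs123`, the simple estimate there, `|T₁| ≤ ‖ψ′(0)‖` — give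
`|T₁|/g_k² ≤ τ` for `0 < g_k ≤ g₀`: `ineq128first_of_simple'` fed to r13 gen 8's
`B16Sect1SmallFactors.ineq128first_div_small` (the exponential `exp(−δMR_{h+1})` inside `rhs123` kills `R_k^{d+β₀}p₀³`).
[cite: Balaban1989LargeFieldII, (1.28) p.363; Balaban1988Convergent, (2.4)–(2.5) p.255] -/
theorem ineq128first_small_of_simple (C r₀ A₀ B₃ B₅ M δ β₀ L p₀ rexp : ℝ) (d : ℕ) (hC : 0 ≤ C) (hr₀ : 0 < r₀)
    (hA₀ : 0 ≤ A₀) (hB₃ : 0 ≤ B₃) (hB₅ : 0 ≤ B₅) (hM : 0 < M) (hδ : 0 < δ) (hβ₀ : 0 ≤ β₀) (hL : 0 ≤ L)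
    (hrexp : 1 ≤ rexp) {τ : ℝ} (hτ : 0 < τ) :
    ∃ g₀ : ℝ, 0 < g₀ ∧ ∀ (gk ℓ Rk Rh1 p₀g εk T₁ : ℝ) (ψ : ℂ → F), 0 < gk → ℓ = Real.log (gk ^ 2)⁻¹ →
      ℓ ^ rexp ≤ Rk → Rk ≤ L * ℓ ^ rexp → Rk ≤ Rh1 → gk ≤ g₀ → p₀g = ℓ ^ p₀ → εk = gk * A₀ * p₀g →
      0 < rhs123 B₃ δ M Rh1 d β₀ Rk εk →
      DifferentiableOn ℂ ψ (ball 0 (r₀ / rhs123 B₃ δ M Rh1 d β₀ Rk εk)) →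
      (∀ z ∈ ball (0 : ℂ) (r₀ / rhs123 B₃ δ M Rh1 d β₀ Rk εk), Ineq128simple ‖ψ z‖ gk C A₀ B₃ B₅ M Rk p₀g d) →
      |T₁| ≤ ‖deriv ψ 0‖ → |T₁| / gk ^ 2 ≤ τ := by
  obtain ⟨g₀, hg₀, h⟩ := B16Sect1SmallFactors.ineq128first_div_small C r₀⁻¹ A₀ B₃ B₅ M δ β₀ L p₀ rexp d hC
    (inv_nonneg.mpr hr₀.le) hA₀ hB₃ hB₅ hM hδ hβ₀ hL hrexp hτ
  refine ⟨g₀, hg₀, ?_⟩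
  intro gk ℓ Rk Rh1 p₀g εk T₁ ψ hgk hℓ hRl hRu hRh hg hp hε h123pos hψ hS hT
  exact h gk ℓ Rk Rh1 p₀g εk T₁ hgk hℓ hRl hRu hRh hg hp hε (ineq128first_of_simple' hr₀ h123pos hψ hS hT)

end

end Literature.MathematicalPhysics.QuantumFieldTheory.Balaban1983to89.B16Ineq128FirstOrder
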